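import Literature.AlgebraicGeometry.HodgeTheory.LimitMixedHodgeStructure
import Literature.AlgebraicGeometry.Motives.MixedHodgeStructurePi
import Literature.AlgebraicGeometry.Motives.MixedHodgeStructureAbelian
import HarnessLib

/-!
# Finite direct sums `⊕ⱼ Lⱼ` of limit mixed Hodge structures of a common weight; the category structure

Topic `Literature/AlgebraicGeometry/HodgeTheory` (namespace `Literature.AlgebraicGeometry.HodgeTheory`). The tree's
`LimitMixedHodgeStructure V k` (`LimitMixedHodgeStructure.lean`) is the limit MHS `(W, F, N)` of weight `k`
(`W = W(N)[-k]`); `LimitMixedHodgeStructureProd.lean` constructs the BINARY direct sum `L₁ ⊕ L₂`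
(`IsMonodromyWeightFiltration.prod`, Deligne (1.6.7)) and `Motives/MixedHodgeStructurePi.lean` the FINITE direct sum
`⊕ⱼ Hⱼ` of mixed Hodge structures with its biproduct morphisms. THIS FILE is the finite direct sum of limit mixed Hodge
structures `Lⱼ = (Wⱼ, Fⱼ, Nⱼ)` of a common weight `k` over a finite index type: `W(⊕ Nⱼ) = ⊕ W(Nⱼ)`
(`IsMonodromyWeightFiltration.pi`, any commutative ring), `LimitMixedHodgeStructure.pi`, the biproduct morphisms
`proj ∕ single ∕ piLift ∕ piDesc` as morphisms of LIMIT MHS (they commute with the `N`'s), and — missing so far for the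
absolute structures — composition, extensionality and inverses of morphisms of limit MHS (`Hom.comp`, `Hom.toLinearMap_injective`,
`Hom.inverse`: a bijective morphism is an isomorphism, Cattani–El Zein–Griffiths–Lê Thm. 3.2.18 plus
`N₁ = f⁻¹ N₂ f`). DEFINITIONS WITH BODIES and theorems (no named fact, no instance; D-0026 net debt `0`).

PRINTED SOURCES, VERBATIM.
* P. Deligne, *La conjecture de Weil. II*, Publ. Math. IHÉS 52 (1980), (1.6.7) (p0032): the monodromy weight
  filtration is compatible with direct sums (the tree's `IsMonodromyWeightFiltration.prod` cites it for two summands).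
* E. Cattani, F. El Zein, P. A. Griffiths, Lê D. T. (eds.), *Hodge Theory* (Math. Notes 49): Thm. 3.2.18 (p0161; the
  category of MHS is abelian, «A morphism of MHS which induces an isomorphism on the lattices, is an isomorphism of
  MHS»), Ex. 3.2.23 (2) (direct sums), Remark 8.2.2 (p0338: «A morphism of limit MHS is compatible with the
  filtrations so that we have an additive category»), Def. 7.5.9 (p0308, polarized MHS ∕ nilpotent orbits
  `(W, F, N)`).
* K. Kato, *On SL(2)-orbit theorems*, Kyoto J. Math. 54 (2014), §2.1, 6: Deligne–Hodge systems «have direct sum,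
  tensor products, symmetric powers, exterior powers, duals, and Tate twists, defined in the evident manners.»
* S. Schreieder, A. Soldatenkov, *The Kuga–Satake construction under degeneration*, J. Inst. Math. Jussieu (2020),
  §2.1.3–2.1.4: morphisms of tuples `(V, F, N)` «preserving … filtrations, and commuting with the nilpotent operators».

THIS FILE (all proved).
* §1 the category structure on the tree's limit MHS of weight `k`: `Hom.toLinearMap_injective` (extensionality), `Hom.comp` (+ `comp_toLinearMap`,
  `comp_id`, `id_comp`, `comp_assoc`), **`Hom.inverse`** of a bijective morphism (+ `inverse_toLinearMap`,
  `inverse_comp`, `comp_inverse`).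
* §2 `IsMonodromyWeightFiltration.pi`: for monodromy weight filtrations `W(Nⱼ)[-c]` on modules `Vⱼ` over a commutative
  ring (finite index type), `j ↦ Π W(Nⱼ)_i` is the monodromy weight filtration of `⊕ Nⱼ` centred at `c`
  (`pi_pow_apply`: `(⊕ Nⱼ)^m` acts componentwise); `isNilpotent_pi`.
* §3 **`LimitMixedHodgeStructure.pi L : LimitMixedHodgeStructure (Π j, W j) k`** for `L j : LimitMixedHodgeStructure (W j) k`:
  the direct-sum MHS `MixedHodgeStructure.pi` with `N = ⊕ Nⱼ` (`pi_toMixedHodgeStructure`, `pi_N`, `pi_N_apply`,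
  `pi_W`, `pi_F`, `hodgeNumber_pi`).
* §4 the biproduct morphisms of LIMIT MHS (index type in `Type`, all summands in one universe, as required by the tree's
  `LimitMixedHodgeStructure.Hom`): `Hom.proj`, `Hom.single`, `Hom.piLift`, `Hom.piDesc`, their underlying maps, the
  identities `proj ∘ single`, `proj ∘ piLift = f`, `piDesc ∘ single = g`, `Σ single ∘ proj = id`, `range_piDesc`,
  `piDesc_injective_of`.

## References

* [Deligne1980] P. Deligne, *La conjecture de Weil. II*, Publ. Math. IHÉS 52 (1980): (1.6.7) (p0032).
* [CattaniElZeinGriffithsLe2014] E. Cattani et al. (eds.), *Hodge Theory*, Math. Notes 49, Princeton UP (2014):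
  Thm. 3.2.18, Ex. 3.2.23 (2) (p0161–p0163), Def. 7.5.9 (p0308), Remark 8.2.2 (p0338).
* [Kato2013] K. Kato, *On SL(2)-orbit theorems*, Kyoto J. Math. 54 (2014) (arXiv:1308.0715): §2.1, 6.
* [SchreiederSoldatenkov2020] S. Schreieder, A. Soldatenkov, J. Inst. Math. Jussieu 19 (2020): §2.1.3–2.1.4.
-/

noncomputable section

open scoped TensorProduct

open Module

universe u v w

namespace Literature.AlgebraicGeometry.HodgeTheory

open Motives Motives.MixedHodgeStructure

/-! ## §1 Composition, extensionality and inverses of morphisms of limit MHS -/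

namespace LimitMixedHodgeStructure

namespace Hom

variable {V : Type u} [AddCommGroup V] [Module ℚ V]
variable {V' : Type u} [AddCommGroup V'] [Module ℚ V']
variable {V'' : Type u} [AddCommGroup V''] [Module ℚ V'']
variable {V''' : Type u} [AddCommGroup V'''] [Module ℚ V''']
variable {k : ℤ}
variable {L₁ : LimitMixedHodgeStructure V k} {L₂ : LimitMixedHodgeStructure V' k} {L₃ : LimitMixedHodgeStructure V'' k}
  {L₄ : LimitMixedHodgeStructure V''' k}

/-- A morphism of limit MHS is determined by its underlying linear map (`toLinearMap` is injective on `Hom L₁ L₂`;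
the extensionality principle of the category). [cite: SchreiederSoldatenkov2020, §2.1.3] -/
theorem toLinearMap_injective :
    Function.Injective fun φ : Hom L₁ L₂ => (φ.toLinearMap : V →ₗ[ℚ] V') := by
  rintro ⟨φ₀, _⟩ ⟨ψ₀, _⟩ h
  have h0 : φ₀ = ψ₀ := MixedHodgeStructure.Hom.ext h
  cases h0
  rfl

/-- **Composition of morphisms of limit mixed Hodge structures** (composition of the morphisms of MHS; the composite
commutes with the `N`'s) — Remark 8.2.2: «we have an additive category». [cite: CattaniElZeinGriffithsLe2014, Remark 8.2.2]
[cite: SchreiederSoldatenkov2020, §2.1.3] -/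
def comp (ψ : Hom L₂ L₃) (φ : Hom L₁ L₂) : Hom L₁ L₃ where
  toHom := ψ.toHom.comp φ.toHom
  comm_N := by
    rw [MixedHodgeStructure.Hom.comp_toLinearMap, LinearMap.comp_assoc, φ.comm_N, ← LinearMap.comp_assoc, ψ.comm_N,
      LinearMap.comp_assoc]

/-- The underlying map of a composite. [cite: CattaniElZeinGriffithsLe2014, Remark 8.2.2] -/
@[simp]
theorem comp_toLinearMap (ψ : Hom L₂ L₃) (φ : Hom L₁ L₂) :
    (ψ.comp φ).toLinearMap = ψ.toLinearMap ∘ₗ φ.toLinearMap :=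
  rfl

/-- The underlying map of the identity. [cite: CattaniElZeinGriffithsLe2014, Remark 8.2.2] -/
@[simp]
theorem id_toLinearMap (L : LimitMixedHodgeStructure V k) : (Hom.id L).toLinearMap = LinearMap.id := rfl

/-- `φ ∘ id = φ`. [cite: CattaniElZeinGriffithsLe2014, Remark 8.2.2] -/
theorem comp_id (φ : Hom L₁ L₂) : φ.comp (Hom.id L₁) = φ := toLinearMap_injective rfl

/-- `id ∘ φ = φ`. [cite: CattaniElZeinGriffithsLe2014, Remark 8.2.2] -/
theorem id_comp (φ : Hom L₁ L₂) : (Hom.id L₂).comp φ = φ := toLinearMap_injective rfl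

/-- Associativity of composition. [cite: CattaniElZeinGriffithsLe2014, Remark 8.2.2] -/
theorem comp_assoc (χ : Hom L₃ L₄) (ψ : Hom L₂ L₃) (φ : Hom L₁ L₂) : (χ.comp ψ).comp φ = χ.comp (ψ.comp φ) :=
  toLinearMap_injective rfl

/-- **A bijective morphism of limit mixed Hodge structures is an isomorphism**: the inverse linear map is a morphism of
MHS (Thm. 3.2.18, the tree's `MixedHodgeStructure.Hom.inverse`) and commutes with the `N`'s (`f N₁ = N₂ f` gives
`f⁻¹ N₂ = N₁ f⁻¹`). [cite: CattaniElZeinGriffithsLe2014, Thm. 3.2.18] [cite: SchreiederSoldatenkov2020, §2.1.3] -/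
def inverse (f : Hom L₁ L₂) (hf : Function.Bijective f.toLinearMap) : Hom L₂ L₁ where
  toHom := f.toHom.inverse hf
  comm_N := by
    refine LinearMap.ext fun y => hf.1 ?_
    have h1 : f.toLinearMap ((f.toHom.inverse hf).toLinearMap (L₂.N y)) = L₂.N y := by
      rw [MixedHodgeStructure.Hom.inverse_toLinearMap]
      exact (LinearEquiv.ofBijective f.toLinearMap hf).apply_symm_apply (L₂.N y)
    have h2 : f.toLinearMap (L₁.N ((f.toHom.inverse hf).toLinearMap y)) = L₂.N y := by
      rw [← LinearMap.comp_apply, f.comm_N, LinearMap.comp_apply, MixedHodgeStructure.Hom.inverse_toLinearMap]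
      exact congrArg L₂.N ((LinearEquiv.ofBijective f.toLinearMap hf).apply_symm_apply y)
    rw [LinearMap.comp_apply, LinearMap.comp_apply]
    exact h1.trans h2.symm

/-- The underlying map of `f.inverse` is the inverse linear equivalence. [cite: CattaniElZeinGriffithsLe2014, Thm. 3.2.18] -/
@[simp]
theorem inverse_toLinearMap (f : Hom L₁ L₂) (hf : Function.Bijective f.toLinearMap) :
    (f.inverse hf).toLinearMap = ((LinearEquiv.ofBijective f.toLinearMap hf).symm : V' →ₗ[ℚ] V) :=
  rfl

/-- `f⁻¹ ∘ f = id`. [cite: CattaniElZeinGriffithsLe2014, Thm. 3.2.18] -/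
theorem inverse_comp (f : Hom L₁ L₂) (hf : Function.Bijective f.toLinearMap) : (f.inverse hf).comp f = Hom.id L₁ :=
  toLinearMap_injective (LinearMap.ext fun x => (LinearEquiv.ofBijective f.toLinearMap hf).symm_apply_apply x)

/-- `f ∘ f⁻¹ = id`. [cite: CattaniElZeinGriffithsLe2014, Thm. 3.2.18] -/
theorem comp_inverse (f : Hom L₁ L₂) (hf : Function.Bijective f.toLinearMap) : f.comp (f.inverse hf) = Hom.id L₂ :=
  toLinearMap_injective (LinearMap.ext fun y => (LinearEquiv.ofBijective f.toLinearMap hf).apply_symm_apply y)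

/-- The inverse of a bijective morphism is bijective. [cite: CattaniElZeinGriffithsLe2014, Thm. 3.2.18] -/
theorem inverse_bijective (f : Hom L₁ L₂) (hf : Function.Bijective f.toLinearMap) :
    Function.Bijective (f.inverse hf).toLinearMap :=
  (LinearEquiv.ofBijective f.toLinearMap hf).symm.bijective

end Hom

end LimitMixedHodgeStructure

/-! ## §2 The monodromy weight filtration of a finite direct sum -/

section MonodromyPi

variable {R : Type u} [CommRing R]
variable {ι : Type w} [Fintype ι]
variable {V : ι → Type v} [∀ j, AddCommGroup (V j)] [∀ j, Module R (V j)]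

omit [Fintype ι] in
/-- `(⊕ⱼ Nⱼ)^m` acts componentwise: `((⊕ Nⱼ)^m x)_j = Nⱼ^m (x_j)`. [cite: Deligne1980, (1.6.7) (p0032)] -/
theorem pi_pow_apply (N : ∀ j, V j →ₗ[R] V j) (m : ℕ) (x : ∀ j, V j) (j : ι) :
    ((LinearMap.pi fun j => N j ∘ₗ LinearMap.proj j) ^ m) x j = (N j ^ m) (x j) := by
  induction m generalizing x with
  | zero => rw [pow_zero, pow_zero, Module.End.one_apply, Module.End.one_apply]
  | succ m ih =>
    rw [pow_succ, pow_succ, Module.End.mul_apply, Module.End.mul_apply, ih]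
    rfl

/-- `⊕ⱼ Nⱼ` is nilpotent when every `Nⱼ` is (finite index type). [cite: Deligne1980, (1.6.7) (p0032)]
[cite: CattaniElZeinGriffithsLe2014, Def. 7.5.9] -/
theorem isNilpotent_pi {N : ∀ j, V j →ₗ[R] V j} (hN : ∀ j, IsNilpotent (N j)) :
    IsNilpotent (LinearMap.pi fun j => N j ∘ₗ LinearMap.proj j) := by
  choose m hm using hN
  refine ⟨∑ j, m j, LinearMap.ext fun x => funext fun j => ?_⟩
  rw [pi_pow_apply, LinearMap.zero_apply, Pi.zero_apply,
    pow_eq_zero_of_le (Finset.single_le_sum (fun i _ => Nat.zero_le (m i)) (Finset.mem_univ j)) (hm j),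
    LinearMap.zero_apply]

omit [Fintype ι] in
/-- A lower bound for finitely many integers. [folklore] -/
private theorem neg_sum_abs_le' [Fintype ι] (P : ι → ℤ) (j : ι) : -∑ i, |P i| ≤ P j := by
  have h1 : |P j| ≤ ∑ i, |P i| :=
    Finset.single_le_sum (f := fun i => |P i|) (fun i _ => abs_nonneg (P i)) (Finset.mem_univ j)
  have h2 : -|P j| ≤ P j := neg_abs_le (P j)
  omega

omit [Fintype ι] in
/-- An upper bound for finitely many integers. [folklore] -/
private theorem le_sum_abs' [Fintype ι] (P : ι → ℤ) (j : ι) : P j ≤ ∑ i, |P i| :=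
  (le_abs_self (P j)).trans
    (Finset.single_le_sum (f := fun i => |P i|) (fun i _ => abs_nonneg (P i)) (Finset.mem_univ j))

/-- **The monodromy weight filtration of a finite direct sum is the direct sum of the monodromy weight filtrations**:
if `Wⱼ = W(Nⱼ)[-c]` on `Vⱼ` for every `j`, then `i ↦ Π_j (Wⱼ)_i` is the monodromy weight filtration of `⊕ⱼ Nⱼ` centred at
`c` — all clauses (`N W_i ⊆ W_{i−2}`, injectivity and surjectivity of `N^ℓ : Gr_{c+ℓ} → Gr_{c−ℓ}`) hold componentwise
(Deligne (1.6.7); the tree's `IsMonodromyWeightFiltration.prod` for two summands). [cite: Deligne1980, (1.6.7) (p0032)] -/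
theorem IsMonodromyWeightFiltration.pi {N : ∀ j, V j →ₗ[R] V j} {c : ℤ} {W : ∀ j, ℤ → Submodule R (V j)}
    (h : ∀ j, IsMonodromyWeightFiltration (N j) c (W j)) :
    IsMonodromyWeightFiltration (LinearMap.pi fun j => N j ∘ₗ LinearMap.proj j) c
      fun i => Submodule.pi Set.univ fun j => W j i where
  monotone a b hab := Submodule.pi_mono fun j _ => (h j).monotone hab
  exists_eq_bot := by
    choose P hP using fun j => (h j).exists_eq_bot
    refine ⟨-∑ j, |P j|, eq_bot_iff.2 fun x hx => ?_⟩
    rw [Submodule.mem_bot]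
    funext j
    have hxj : x j ∈ W j (P j) := (h j).monotone (neg_sum_abs_le' P j) (hx j trivial)
    rw [hP j, Submodule.mem_bot] at hxj
    exact hxj
  exists_eq_top := by
    choose P hP using fun j => (h j).exists_eq_top
    refine ⟨∑ j, |P j|, eq_top_iff.2 fun x _ j _ => ?_⟩
    exact (h j).monotone (le_sum_abs' P j) (by rw [hP j]; exact Submodule.mem_top)
  map_le i := by
    rintro _ ⟨x, hx, rfl⟩ j -
    exact (h j).map_le i ⟨x j, hx j trivial, rfl⟩
  inf_comap_le ℓ := by
    intro x hx j _
    have hx₁ := (Submodule.mem_inf.1 hx).1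
    have hx₂ := Submodule.mem_comap.1 (Submodule.mem_inf.1 hx).2
    refine (h j).inf_comap_le ℓ (Submodule.mem_inf.2 ⟨hx₁ j trivial, Submodule.mem_comap.2 ?_⟩)
    rw [← pi_pow_apply]
    exact hx₂ j trivial
  le_map_sup ℓ := by
    intro x hx
    have hx' : ∀ j, x j ∈ (W j (c + ℓ)).map (N j ^ ℓ) ⊔ W j (c - ℓ - 1) := fun j =>
      (h j).le_map_sup ℓ (hx j trivial)
    choose y hy z hz hyz using fun j => Submodule.mem_sup.1 (hx' j)
    choose y' hy' hyy' using fun j => Submodule.mem_map.1 (hy j)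
    refine Submodule.mem_sup.2 ⟨((LinearMap.pi fun j => N j ∘ₗ LinearMap.proj j) ^ ℓ) fun j => y' j,
      ⟨fun j => y' j, fun j _ => hy' j, rfl⟩, fun j => z j, fun j _ => hz j, funext fun j => ?_⟩
    rw [Pi.add_apply, pi_pow_apply, hyy', hyz]

end MonodromyPi

/-! ## §3 The direct sum `⊕ⱼ Lⱼ` of limit mixed Hodge structures of weight `k` -/

namespace LimitMixedHodgeStructure

section Pi

variable {ι : Type w} [Fintype ι] [DecidableEq ι]
variable {W : ι → Type v} [∀ j, AddCommGroup (W j)] [∀ j, Module ℚ (W j)]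
variable {k : ℤ}

/-- **The direct sum `⊕ⱼ Lⱼ` of a finite family of limit mixed Hodge structures of the same weight `k`**: the
direct-sum MHS (`MixedHodgeStructure.pi`: `W_i = Π W_i(Lⱼ)`, `F^p = Π F^p(Lⱼ)`, Thm. 3.2.18 ∕ Ex. 3.2.23 (2)) with the
nilpotent endomorphism `N = ⊕ⱼ Nⱼ` (`N_ℂ F^p ⊆ F^{p−1}` componentwise) and `W = W(⊕ Nⱼ)[-k]` by
`IsMonodromyWeightFiltration.pi` (Deligne (1.6.7)). Kato's «direct sum … defined in the evident manners»; the finite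
biproduct of the additive category of limit MHS (Remark 8.2.2). [cite: CattaniElZeinGriffithsLe2014, Ex. 3.2.23 (2), Def. 7.5.9 and Remark 8.2.2]
[cite: Deligne1980, (1.6.7) (p0032)] [cite: Kato2013, §2.1, 6] -/
def pi (L : ∀ j, LimitMixedHodgeStructure (W j) k) : LimitMixedHodgeStructure (∀ j, W j) k where
  toMixedHodgeStructure := MixedHodgeStructure.pi fun j => (L j).toMixedHodgeStructure
  N := LinearMap.pi fun j => (L j).N ∘ₗ LinearMap.proj j
  isNilpotent_N := isNilpotent_pi fun j => (L j).isNilpotent_N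
  map_N_F_le p := by
    rintro _ ⟨x, hx, rfl⟩
    have hx' := (MixedHodgeStructure.mem_pi_F_iff fun j => (L j).toMixedHodgeStructure).1 hx
    refine (MixedHodgeStructure.mem_pi_F_iff fun j => (L j).toMixedHodgeStructure).2 fun j => ?_
    rw [← HodgeStructure.proj_baseChange_apply, ← LinearMap.comp_apply, ← LinearMap.baseChange_comp,
      LinearMap.proj_pi, LinearMap.baseChange_comp, LinearMap.comp_apply, HodgeStructure.proj_baseChange_apply]
    exact (L j).map_N_F_le p ⟨_, hx' j, rfl⟩
  isMonodromyWeightFiltration := IsMonodromyWeightFiltration.pi fun j => (L j).isMonodromyWeightFiltration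

variable (L : ∀ j, LimitMixedHodgeStructure (W j) k)

/-- The underlying MHS of `⊕ⱼ Lⱼ` is the direct-sum MHS. [cite: CattaniElZeinGriffithsLe2014, Ex. 3.2.23 (2)] -/
@[simp]
theorem pi_toMixedHodgeStructure :
    (pi L).toMixedHodgeStructure = MixedHodgeStructure.pi fun j => (L j).toMixedHodgeStructure :=
  rfl

/-- `N(⊕ⱼ Lⱼ) = ⊕ⱼ Nⱼ`. [cite: CattaniElZeinGriffithsLe2014, Def. 7.5.9] -/
@[simp]
theorem pi_N : (pi L).N = LinearMap.pi fun j => (L j).N ∘ₗ LinearMap.proj j := rfl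

/-- `(N(⊕ⱼ Lⱼ) x)_j = Nⱼ (x_j)`. [cite: CattaniElZeinGriffithsLe2014, Def. 7.5.9] -/
theorem pi_N_apply (x : ∀ j, W j) (j : ι) : (pi L).N x j = (L j).N (x j) := rfl

/-- `W_i(⊕ⱼ Lⱼ) = Π W_i(Lⱼ)`. [cite: Deligne1980, (1.6.7) (p0032)] -/
theorem pi_W (i : ℤ) : (pi L).W i = Submodule.pi Set.univ fun j => (L j).W i := rfl

/-- `F^p(⊕ⱼ Lⱼ) = Π F^p(Lⱼ)` under the tree's `piEquiv : ℂ ⊗ (Π Wⱼ) ≃ Π (ℂ ⊗ Wⱼ)`. [cite: CattaniElZeinGriffithsLe2014, Ex. 3.2.23 (2)] -/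
theorem pi_F (p : ℤ) :
    (pi L).F p =
      (Submodule.pi Set.univ fun j => (L j).F p).comap
        (HodgeStructure.piEquiv W : ℂ ⊗[ℚ] (∀ j, W j) →ₗ[ℂ] ∀ j, ℂ ⊗[ℚ] W j) :=
  rfl

/-- **`h^{p,q}(⊕ⱼ Lⱼ) = Σ_j h^{p,q}(Lⱼ)`.** [cite: CattaniElZeinGriffithsLe2014, Cor. 3.2.21 (ii)] -/
theorem hodgeNumber_pi [∀ j, FiniteDimensional ℚ (W j)] (p q : ℤ) :
    (pi L).toMixedHodgeStructure.hodgeNumber p q = ∑ j, (L j).toMixedHodgeStructure.hodgeNumber p q :=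
  MixedHodgeStructure.hodgeNumber_pi _ p q

end Pi

/-! ## §4 The biproduct morphisms `proj`, `single`, `piLift`, `piDesc` of limit MHS -/

namespace Hom

/- The tree's `LimitMixedHodgeStructure.Hom` relates structures on spaces in ONE universe; for `Hom (pi L) (L j)` the
index type is therefore taken in `Type` (e.g. `Fin n`, a `Finset` coerced to a type), so that `Π j, W j` lives in the
universe of the `W j`. -/

variable {ι : Type} [Fintype ι] [DecidableEq ι]
variable {W : ι → Type v} [∀ j, AddCommGroup (W j)] [∀ j, Module ℚ (W j)]
variable {U : Type v} [AddCommGroup U] [Module ℚ U]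
variable {k : ℤ}
variable (L : ∀ j, LimitMixedHodgeStructure (W j) k) {L₀ : LimitMixedHodgeStructure U k}

/-- **The projection `⊕ⱼ Lⱼ → Lⱼ` is a morphism of limit MHS** (a morphism of MHS; `(⊕ Nⱼ x)_j = Nⱼ x_j`).
[cite: CattaniElZeinGriffithsLe2014, Thm. 3.2.18 and Remark 8.2.2] -/
def proj (j : ι) : Hom (pi L) (L j) where
  toHom := MixedHodgeStructure.Hom.proj (fun j => (L j).toMixedHodgeStructure) j
  comm_N := rfl

/-- The underlying map of `proj j`. [cite: CattaniElZeinGriffithsLe2014, Thm. 3.2.18] -/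
@[simp]
theorem proj_toLinearMap (j : ι) : (proj L j).toLinearMap = LinearMap.proj j := rfl

/-- **The inclusion `Lⱼ → ⊕ⱼ Lⱼ` is a morphism of limit MHS** (a morphism of MHS; `⊕ Nⱼ (ι_j x) = ι_j (Nⱼ x)`).
[cite: CattaniElZeinGriffithsLe2014, Thm. 3.2.18 and Remark 8.2.2] -/
def single (j : ι) : Hom (L j) (pi L) where
  toHom := MixedHodgeStructure.Hom.single (fun j => (L j).toMixedHodgeStructure) j
  comm_N := by
    refine LinearMap.ext fun x => funext fun i => ?_
    show (Pi.single j ((L j).N x) : ∀ j, W j) i = (L i).N ((Pi.single j x : ∀ j, W j) i)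
    rw [Pi.apply_single (fun i (y : W i) => (L i).N y) (fun i => map_zero _) j x i]

/-- The underlying map of `single j` is `Pi.single j`. [cite: CattaniElZeinGriffithsLe2014, Thm. 3.2.18] -/
@[simp]
theorem single_toLinearMap_apply (j : ι) (x : W j) : (single L j).toLinearMap x = Pi.single j x := rfl

/-- `proj j ∘ single j = id`. [cite: CattaniElZeinGriffithsLe2014, Thm. 3.2.18] -/
theorem proj_comp_single_same (j : ι) : (proj L j).comp (single L j) = Hom.id (L j) :=
  toLinearMap_injective (LinearMap.ext fun x => Pi.single_eq_same j x)

/-- `proj i ∘ single j = 0` on vectors for `i ≠ j`. [cite: CattaniElZeinGriffithsLe2014, Thm. 3.2.18] -/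
theorem proj_comp_single_ne {i j : ι} (hij : i ≠ j) : (proj L i).toLinearMap ∘ₗ (single L j).toLinearMap = 0 :=
  LinearMap.ext fun x => Pi.single_eq_of_ne hij x

/-- `single j` is injective. [cite: CattaniElZeinGriffithsLe2014, Thm. 3.2.18] -/
theorem single_injective (j : ι) : Function.Injective (single L j).toLinearMap :=
  Pi.single_injective (M := fun j => W j) j

/-- `proj j` is surjective. [cite: CattaniElZeinGriffithsLe2014, Thm. 3.2.18] -/
theorem proj_surjective (j : ι) : Function.Surjective (proj L j).toLinearMap := fun x =>
  ⟨Pi.single j x, Pi.single_eq_same j x⟩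

/-- **The morphism `L₀ → ⊕ⱼ Lⱼ` of limit MHS defined by a family `f_j : L₀ → Lⱼ`** (product universal property).
[cite: CattaniElZeinGriffithsLe2014, Thm. 3.2.18 and Remark 8.2.2] -/
def piLift (f : ∀ j, Hom L₀ (L j)) : Hom L₀ (pi L) where
  toHom := MixedHodgeStructure.Hom.piLift (fun j => (L j).toMixedHodgeStructure) fun j => (f j).toHom
  comm_N := LinearMap.ext fun x => funext fun j => LinearMap.congr_fun (f j).comm_N x

/-- Components of `piLift f`. [cite: CattaniElZeinGriffithsLe2014, Thm. 3.2.18] -/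
@[simp]
theorem piLift_toLinearMap_apply (f : ∀ j, Hom L₀ (L j)) (x : U) (j : ι) :
    (piLift L f).toLinearMap x j = (f j).toLinearMap x :=
  rfl

/-- `proj j ∘ piLift f = f j`. [cite: CattaniElZeinGriffithsLe2014, Thm. 3.2.18] -/
theorem proj_comp_piLift (f : ∀ j, Hom L₀ (L j)) (j : ι) : (proj L j).comp (piLift L f) = f j :=
  toLinearMap_injective rfl

/-- **The morphism `⊕ⱼ Lⱼ → L₀` of limit MHS defined by a family `g_j : Lⱼ → L₀`**, `x ↦ Σ_j g_j(x_j)` (coproduct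
universal property; `N₀ (Σ g_j x_j) = Σ g_j (Nⱼ x_j)`). [cite: CattaniElZeinGriffithsLe2014, Thm. 3.2.18 and Remark 8.2.2] -/
def piDesc (g : ∀ j, Hom (L j) L₀) : Hom (pi L) L₀ where
  toHom := MixedHodgeStructure.Hom.piDesc (fun j => (L j).toMixedHodgeStructure) fun j => (g j).toHom
  comm_N := by
    refine LinearMap.ext fun x => ?_
    rw [LinearMap.comp_apply, LinearMap.comp_apply, MixedHodgeStructure.Hom.piDesc_toLinearMap_apply,
      MixedHodgeStructure.Hom.piDesc_toLinearMap_apply, map_sum]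
    exact Finset.sum_congr rfl fun j _ => LinearMap.congr_fun (g j).comm_N (x j)

/-- `piDesc g (x) = Σ_j g_j (x_j)`. [cite: CattaniElZeinGriffithsLe2014, Thm. 3.2.18] -/
theorem piDesc_toLinearMap_apply (g : ∀ j, Hom (L j) L₀) (x : ∀ j, W j) :
    (piDesc L g).toLinearMap x = ∑ j, (g j).toLinearMap (x j) :=
  MixedHodgeStructure.Hom.piDesc_toLinearMap_apply _ x

/-- `piDesc g ∘ single j = g j`. [cite: CattaniElZeinGriffithsLe2014, Thm. 3.2.18] -/
theorem piDesc_comp_single (g : ∀ j, Hom (L j) L₀) (j : ι) : (piDesc L g).comp (single L j) = g j := by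
  refine toLinearMap_injective (LinearMap.ext fun x => ?_)
  show ((piDesc L g).comp (single L j)).toLinearMap x = (g j).toLinearMap x
  rw [comp_toLinearMap, LinearMap.comp_apply, single_toLinearMap_apply, piDesc_toLinearMap_apply,
    Finset.sum_eq_single j (fun i _ hij => by rw [Pi.single_eq_of_ne hij, map_zero])
      (fun h => (h (Finset.mem_univ j)).elim),
    Pi.single_eq_same]

/-- `Σ_j single j (x_j) = x`: the inclusions jointly generate `⊕ⱼ Lⱼ`. [cite: CattaniElZeinGriffithsLe2014, Thm. 3.2.18] -/
theorem sum_single_apply (x : ∀ j, W j) : ∑ j, (single L j).toLinearMap (x j) = x := by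
  simp only [single_toLinearMap_apply]
  exact Finset.univ_sum_single x

/-- **The image of `piDesc g` is `Σ_j Im(g_j)`.** [cite: CattaniElZeinGriffithsLe2014, Thm. 3.2.18] -/
theorem range_piDesc (g : ∀ j, Hom (L j) L₀) :
    LinearMap.range (piDesc L g).toLinearMap = ⨆ j, LinearMap.range (g j).toLinearMap := by
  refine le_antisymm ?_ (iSup_le fun j => ?_)
  · rintro _ ⟨x, rfl⟩
    rw [piDesc_toLinearMap_apply]
    exact Submodule.sum_mem _ fun j _ => Submodule.mem_iSup_of_mem j (LinearMap.mem_range_self _ _)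
  · rintro _ ⟨x, rfl⟩
    refine ⟨Pi.single j x, ?_⟩
    have h := congrArg (fun φ : Hom (L j) L₀ => φ.toLinearMap x) (piDesc_comp_single L g j)
    simpa only [comp_toLinearMap, LinearMap.comp_apply, single_toLinearMap_apply] using h

/-- **`piDesc g` is injective when `Σ_j g_j(u_j) = 0` forces all `u_j = 0`** (i.e. the `g_j` are injective with
independent images).
[cite: CattaniElZeinGriffithsLe2014, Thm. 3.2.18] -/
theorem piDesc_injective_of (g : ∀ j, Hom (L j) L₀)
    (h : ∀ u : ∀ j, W j, ∑ j, (g j).toLinearMap (u j) = 0 → u = 0) :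
    Function.Injective (piDesc L g).toLinearMap :=
  (injective_iff_map_eq_zero _).2 fun u hu => h u (by rwa [piDesc_toLinearMap_apply] at hu)

end Hom

end LimitMixedHodgeStructure

end Literature.AlgebraicGeometry.HodgeTheory
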